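import Summits.QuantumFields.YangMills.Theorems.AlphaInputsT3ACv3LaneCore
import Summits.QuantumFields.YangMills.Theorems.AlphaInputsT3ACv3SmallFactor
import HarnessLib

/-!
# `UnitScaleTiltHistoryTailCoreRunRows` — crux `HistoryTailL` (stmt-QuantumFields-19936), R-57χ successor line (owner RULING g23-№2 ADD. 5/6): the two lane-generic rows the
# 19936 numerator reads from an (α) run, RE-DERIVED FOR A CORE RUN `AlphaV3AC.RunAlphaV3CoreAC` (★alpha-1's `AlphaInputsT3ACv3LaneCore`: every (α) row except the lower
# residual) — (46) p.267 one step up (`abs_Pint_succ_le_of_alphaV3Core`; reads `h44`/`hfloor`/`chart`/`bound28`/`far_le`/`hPY`/`hPYZ`) and (71) p.273 per recorded large-field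
# plaquette (`eq71_perPlaquette_of_alphaV3Core`; reads `hLF67`/`h68`).  Proofs = `AlphaV3AC.abs_Pint_succ_le_of_alphaV3` (`AlphaInputsT3ACv3Pint`) and
# `AlphaV3AC.eq71_perPlaquette_of_alphaV3` (`AlphaInputsT3ACv3SmallFactor`) VERBATIM with `R : RunAlphaV3AC ↦ RunAlphaV3CoreAC` (★alpha-1 g3's proofs; they read only core rows),
# so both the old record (`RunAlphaV3AC.toCore`) and the χ-record (`RunAlphaV3ChiAC.toCore`) get them — seat ym3-torus-p2 (g16); `--supports` 19936

Nothing of [Balaban1985UV3] is asserted; CONDITIONAL only on the core run `R`.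

References: T. Bałaban, Commun. Math. Phys. 102 (1985) 255–275 [Balaban1985UV3] ((33)–(34) p.264, (44)–(46) p.267, (61) p.271, (67)–(71) p.273); Commun. Math. Phys. 98 (1985)
17–51 [Balaban1985Averaging] ((42)–(43) p.24).
-/

set_option autoImplicit false

noncomputable section

namespace Summit.QuantumFields.YangMills.Theorems

open MeasureTheory
open scoped BigOperators Matrix.Norms.L2Operator
open Literature.MathematicalPhysics.QuantumFieldTheory.Balaban1983to89
open Literature.MathematicalPhysics.QuantumFieldTheory.Balaban1983to89.T3ContinuumYM3Torus
open Literature.MathematicalPhysics.QuantumFieldTheory.Balaban1983to89.T3UnitLawDensityEML (ℰp)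
open Literature.MathematicalPhysics.QuantumFieldTheory.Balaban1983to89.T3UnitScaleTilt (θBal)
open Literature.MathematicalPhysics.QuantumFieldTheory.Balaban1983to89.T3AlphaInputsAC
open Literature.MathematicalPhysics.QuantumFieldTheory.Balaban1985CMP102
open Literature.MathematicalPhysics.QuantumFieldTheory.Balaban1985CMP102.Setting
open Summit.QuantumFields.Balaban3D.Carriers
open Summit.QuantumFields.Balaban3D.Proofs.Primitives
open Summit.QuantumFields.Balaban3D.Proofs.ScalesArithmetic (gk_pos gk_le_one gk_sq g0sq_pos gk_eq_gRun_norm card_site_eq)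
open Summit.QuantumFields.Balaban3D.Proofs.UVStability3DInputs (adjAct)
open Summit.QuantumFields.Balaban3D.Proofs.GroupModelLieC (lieC)
open Summit.QuantumFields.Balaban3D.Proofs.FamilyLE (thresholds_of_le)
open Summit.QuantumFields.Balaban3D.Proofs.TowerAC
open Summit.QuantumFields.Balaban3D.Proofs.StandardAC
open Summit.QuantumFields.Balaban3D.Proofs.InputsAC
open Summit.QuantumFields.Balaban3D.Proofs.AlphaAC (AlphaDataAC)
open Summit.QuantumFields.Balaban3D.Proofs.Bound46AC (abs_pint_le_stdAC)
open Summit.QuantumFields.Balaban3D.Proofs.TorusLift (projSite zOf projSite_injOn_deltaBox)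
open Summit.QuantumFields.Balaban3D.Proofs.LiftBridge (liftCfg liftCfg_mem_unitaryUnits bridge_liftCfg)
open Summit.QuantumFields.Balaban3D.Proofs.Run3SmallFactors (codeZ regionT decode_of_mem_disc)
open Summit.QuantumFields.Balaban3D.Proofs.PerPlaquette71 (perPlaquette71_local_gamma)
open B7Prop1Explicit (hol plaqWord)
open B7Prop2Explicit (avgIter)
open B10Eq70Squaring (deltaBox)

/-! ## §1 (46) one step up for the AC tower of a CORE (α) run, on the `≤`-family -/

namespace AlphaV3AC

variable {L : ℕ} {S : Scales L} {G : Type} [GaugeGroup G] [MeasurableSpace G] [HaarData G] {𝔊 : GroupModel G} {𝔠 : AlphaConsts L 𝔊.N}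
  {X : ExternalInputsAC S G} {𝔖 : ∀ k, StepSeries S G ↥(lieC 𝔊) (nblkOf S 𝔠.lane.carrier k) k} {𝔄 : AlphaDataAC 𝔊 𝔠 X 𝔖}
  {win : (k : ℕ) → Hist S.P (k + 1) → Set (GaugeField S.P (k + 1) G)}
  (hle : S.g ^ 2 * S.ε₀ ≤ (min 𝔠.gamma0 1) ^ 2)
include hle

/-- **(46) FOR THE AC TOWER OF A CORE (α) RUN `RunAlphaV3CoreAC`, ONE STEP UP, every `k < K`** (`abs_Pint_succ_le_of_alphaV3`'s proof: only core rows are read) (on the `≤`-family `g²ε₀ ≤ (min γ₀ 1)²`): `|Pint_{k+1}(h, U)| ≤ (C46·M₁³)·(g_kp(g_k))²·#Ω_{k+1}^{(k+1)}(h)`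
— `Bound46AC.abs_pint_le_stdAC` fed by the rows `h44`/`hfloor` (old slice), `chart`/`bound28`/`far_le`/`hPY`/`hPYZ` + the binders `𝔄.Λc`/`𝔄.N45` (newborn slice), the thresholds
`γ₄₆` and the (28)-smallness from `g_k ≤ γ₀` (`FamilyLE.thresholds_of_le`). [cite: Balaban1985UV3, (44)–(46) p.267 + (33)–(34) p.264 + (61) p.271] -/
theorem abs_Pint_succ_le_of_alphaV3Core (R : RunAlphaV3CoreAC 𝔊 𝔠 X 𝔖 𝔄 win) (k : ℕ) (hk : k + 1 ≤ S.K) (h : Hist S.P (k + 1))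
    (U : GaugeField S.P (k + 1) G) :
    |(inputOfAC 𝔠.lane X 𝔖).Pint (k + 1) h U| ≤
      (𝔠.C46 * (𝔠.M₁ : ℝ) ^ 3) * (S.gk k * B10.pFun 𝔠.b₀ 𝔠.p₀ (S.gk k)) ^ 2 * (LamFin 𝔠.lane.carrier.M₁ (rcolOf S 𝔠.lane.carrier) k h).card := by
  rw [𝔠.C46_mul_M₁_cube_eq]
  exact abs_pint_le_stdAC X 𝔠.lane.carrier 𝔖 𝔠.C44_nonneg 𝔠.B₃_pos.le 𝔠.κ₁_pos 𝔠.M₁_pos 𝔠.b₀_pos 𝔠.p₀_pos 𝔠.chart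
    (by linarith [𝔠.kappa_ge]) 𝔠.C25_nonneg 𝔠.C63_nonneg (lt_of_lt_of_le one_pos 𝔠.one_le_r₀)
    (fun j hj => (R.steps j hj).h44) (fun j hj => (R.steps j hj).hfloor) (fun j hj => (thresholds_of_le hle j (by omega)).2.1)
    (fun j hj => (R.steps j hj).chart) (fun j hj => (R.steps j hj).bound28) (fun j hj => (thresholds_of_le hle j (by omega)).2.2.2.2)
    (fun j hj => (R.steps j hj).far_le) (fun j hj => (R.steps j hj).hPY) (π := fun j => adjAct 𝔊 (P := S.P) j) (fun j _ => 𝔄.Λc j)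
    (fun j _ => 𝔄.N45 j) (fun j hj => (R.steps j hj).hPYZ) k hk h U

end AlphaV3AC

/-! ## §2 (71) per recorded plaquette for the AC tower of a CORE (α) run -/

namespace AlphaV3AC

variable {L : ℕ} {S : Scales L} {G : Type} [GaugeGroup G] [MeasurableSpace G] [HaarData G] {𝔊 : GroupModel G} {𝔠 : AlphaConsts L 𝔊.N}
  {X : ExternalInputsAC S G} {𝔖 : ∀ k, StepSeries S G ↥(lieC 𝔊) (nblkOf S 𝔠.lane.carrier k) k} {𝔄 : AlphaDataAC 𝔊 𝔠 X 𝔖}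
  {win : (k : ℕ) → Hist S.P (k + 1) → Set (GaugeField S.P (k + 1) G)}
  (hle : S.g ^ 2 * S.ε₀ ≤ (min 𝔠.gamma0 1) ^ 2)
include hle

/-- **(71) PER RECORDED LARGE-FIELD PLAQUETTE, FOR THE AC TOWER OF A CORE (α) RUN `RunAlphaV3CoreAC`** (`eq71_perPlaquette_of_alphaV3`'s proof: only the core rows `hLF67`/`h68` are read) (p.273 L11–22; the `h71` of `Run3SmallFactors.smallFactorsAdm_tower3` for ONE plaquette,
from the v3 rows): on the `≤`-family, for `k ≤ K`, an ADMISSIBLE history `h`, every field `U` and every `e = (j, code p′) ∈ P(h)`,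
`p(g_j)²/4 ≤ N·((1/g_k²)·Σ_{q ∈ regionT e} η_k⁻¹[1 − reTr U_k(h,U)(∂q)])` — `PerPlaquette71.perPlaquette71_local_gamma` at the lifted composite minimiser `liftCfg 𝔊 (U_k(h,U))` with
`V_j := Ū^j` (so (67) by `rfl`), the large-field row `hLF67`, the regularity row `h68`, the threshold `γ₇₁` (`FamilyLE.thresholds_of_le`), the running coupling `g_i = gRun 1 L g₀² i`, and the
plaquette bridge `LiftBridge.bridge_liftCfg` (the box sum over `deltaBox` = the sum over the torus region `regionT e`, `projSite` injective on the box). [cite: Balaban1985UV3, (67)–(71) p.273] -/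
theorem eq71_perPlaquette_of_alphaV3Core (hL : 2 ≤ L) (R : RunAlphaV3CoreAC 𝔊 𝔠 X 𝔖 𝔄 win) (k : ℕ) (hk : k ≤ S.K) (h : Hist S.P k)
    (hh : Hist.Admissible 𝔠.lane.carrier.M₁ (rcolOf S 𝔠.lane.carrier) k h) (U : GaugeField S.P k G) (e : ℕ × PlaqCode S.P)
    (he : e ∈ Hist.disc h) :
    B10.pFun 𝔠.lane.carrier.b₀ 𝔠.lane.carrier.p₀ (S.gk e.1) ^ 2 / 4 ≤
      (𝔊.N : ℝ) * ((S.gk k)⁻¹ ^ 2 * ∑ q ∈ regionT e, (S.eta k)⁻¹ * (1 - reTr (GaugeField.plaqHol (X.UkH k h U) q))) := by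
  classical
  haveI : NeZero 𝔊.N := ⟨Nat.pos_iff_ne_zero.mp 𝔊.N_pos⟩
  obtain ⟨j, hj, p', hp', hej, hz, hμ, hν⟩ := decode_of_mem_disc he
  have hμν : e.2.2.1 < e.2.2.2 := by rw [hμ, hν]; exact p'.hμν
  have he1 : e.1 = j := by rw [hej]
  have key := perPlaquette71_local_gamma L hL one_pos (g0sq_pos S) 𝔠.lane.F.b₀_pos 𝔠.lane.F.p₀_pos 𝔠.C68_pos S.gk
    (gk_eq_gRun_norm S) (j := e.1) (k := k) (by omega) ((thresholds_of_le hle e.1 (by omega)).2.2.2.1)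
    (liftCfg 𝔊 (X.UkH k h U)) (avgIter L (liftCfg 𝔊 (X.UkH k h U)) e.1) (fun x κ => liftCfg_mem_unitaryUnits 𝔊 _ x κ)
    (codeZ e) (ne_of_lt hμν) rfl (R.hLF67 k hk h hh U e he) (R.h68 k hk h hh U e he)
  refine key.trans (le_of_eq ?_)
  congr 1
  congr 1
  have h2 : 2 * L ^ e.1 ≤ S.P.sitesPerDir 0 := by
    show 2 * L ^ e.1 ≤ 2 * L ^ (S.m + S.K - 0)
    rw [Nat.sub_zero]
    exact Nat.mul_le_mul_left 2 (Nat.pow_le_pow_right (by omega) (by omega))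
  unfold Summit.QuantumFields.Balaban3D.Proofs.Run3SmallFactors.regionT
  rw [dif_pos hμν, @Finset.sum_image _ _ _ _ _ (instDecidableEqPlaq (P := S.P) (j := 0)) _ _ ?inj]
  · refine Finset.sum_congr rfl fun y _ => ?_
    exact (bridge_liftCfg 𝔊 k (X.UkH k h U) y hμν).symm
  · intro y hy y' hy' hyy
    exact projSite_injOn_deltaBox h2 _ _ _ hy hy' (congrArg Plaq.src hyy)

end AlphaV3AC

end Summit.QuantumFields.YangMills.Theorems

end
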